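import Summits.Ventures.Crystal3D.Theorems.StickyWulffConstantCoaxialWallLawTwoLatticeTransPlates
import Summits.Ventures.Crystal3D.Theorems.StickyWulffConstantCoaxialWallLawEndRowDefs
import Summits.Ventures.Crystal3D.Theorems.StickyWulffConstantCoaxialWallLawWordNoGlideMirror
import HarnessLib

/-!
# Readings in a two-lattice configuration III: END PAIRS OF THE CENSUS ROWS COME FROM ROOT CLASSES
# (crux `CoaxialWallLaw`, stmt-Ventures-19481, line `WallLedgerF`; interpretation completeness, part 3)

HONEST FRAMING. Venture `Summits/Ventures/Crystal3D` (cell `crystal3d-full`), helper `--supports` the crux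
`CoaxialWallLaw` of `route-Ventures-StickyWulffConstant` (REGISTERED line `WallLedgerF`).  Rung credit; F-C1 not
moved; no census, no kissing facts.  cf-p1 g28 §86(79)/(86) item (3) (19481-p2 g7): the COMPLETENESS statement the
F STEP-3 certificate needs about its class set.  The typed row `LocalEndRow v s_F S₁ S₂` (`…EndRowDefs`) counts end
pairs over ALL admissible classes `(G, d) ∈ S₁.Adm ∪ S₂.Adm` (frames `S.Fw κ` of arbitrarily long well-formed chains
`κ`); the certificate engine enumerates chains to crossing depth 2.  On the census's ON-SITE universe this loses
nothing:

* word rigidity for plate systems: `PlateSystem.chain_eq_nil_of_image_eq` (a chain whose frame has the plate frame's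
  slot dozen is EMPTY — `word_eq_of_image_eq`), `PlateSystem.image_ne_basalMirror` (no chain over an in-plane root has the
  slot dozen of the BASAL mirror of the plate frame — `word_image_ne_cons_of_inner_zero`);
* **`isEndPair_rootClass_twinPlates`** — TWIN plates (`EndRowTwinHalfTurn`: `S₁ = ⟨L, inPlaneRoots L 1⟩`,
  `S₂ = ⟨H∘L, inPlaneRoots (H∘L) (−1)⟩`), `X ⊆ (L·Λ₀ + s₁) ∪ ((H∘L)·Λ₀ + s₂)`: every `v1` end pair `(b, q)` is witnessed
  by a ROOT class — `(G, d) = (L, L r)` with `r ∈ inPlaneRoots L 1` or `(H∘L, (H∘L) r)` with `r ∈ inPlaneRoots (H∘L) (−1)`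
  — and every twin reading in it has normal `±L e₃` (`isTwinReading_normal_twinPlates`);
* **`isEndPair_rootClass_transPlates`** — TRANSLATION plates (`EndRowTrans`: `Sᵢ = ⟨L, inPlaneRoots L (±1)⟩`),
  `X ⊆ (L·Λ₀ + s₁) ∪ (L·Λ₀ + s₂)` with the offset either DEEP (`L⁻¹(3(s₂ − s₁)) ∉ Λ₀`) or a BASAL FAULT
  (`s₂ − s₁ ≡ a'√(2/3)·(L e₃)`, `L⁻¹(s₂ − s₁) ∉ Λ₀`): every `v1` end pair is witnessed by a root class `(L, L r)`,
  `r ∈ inPlaneRoots L 1 ∪ inPlaneRoots L (−1)`; in the deep case no twin reading occurs at all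
  (`not_isTwinReading_transPlates_of_deep`).
So for on-site patterns the certificate's class set {root classes} ∪ (anything deeper) is COMPLETE for the typed rows at
`WordVersion.v1`.  WHAT THIS IS NOT: the rows quantify over ALL finite configurations, not only on-site ones — off-site
balls and third-lattice lamellae are outside this file; not the certificate; F-C1 not moved.
-/

noncomputable section

namespace Summit.Ventures.Crystal3D.Theorems

open Summit.Ventures.Crystal3D Finset
open Literature.MathematicalPhysics.StatisticalMechanics (fccStacking)
open scoped InnerProductSpace

/-! ### Word rigidity for plate systems -/

namespace PlateSystem

/-- The frame recursion of a plate system (definitional). -/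
theorem fw_cons (S : PlateSystem) (μ : EuclideanSpace ℝ (Fin 3)) (κ : List (EuclideanSpace ℝ (Fin 3))) :
    S.Fw (μ :: κ) = ((ℝ ∙ μ)ᗮ.reflection).trans (S.Fw κ) := rfl

/-- The root-direction recursion `u (μ :: κ) = −u κ` for `u κ = (−1)^{|κ|} • r`. -/
theorem u_cons (r μ : EuclideanSpace ℝ (Fin 3)) (κ : List (EuclideanSpace ℝ (Fin 3))) :
    ((-1 : ℝ) ^ (μ :: κ).length) • r = -(((-1 : ℝ) ^ κ.length) • r) := by
  rw [List.length_cons, pow_succ, mul_neg_one, neg_smul]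

/-- The well-formedness recursion (definitional). -/
theorem wfChain_cons (r μ : EuclideanSpace ℝ (Fin 3)) (κ : List (EuclideanSpace ℝ (Fin 3))) :
    WFChain r (μ :: κ) ↔ (WFChain r κ ∧ ‖μ‖ = 1 ∧
      (∀ w ∈ fccSlots, ⟪w, μ⟫_ℝ = 0 ∨ ⟪w, μ⟫_ℝ = Real.sqrt (2 / 3) ∨ ⟪w, μ⟫_ℝ = -Real.sqrt (2 / 3)) ∧
      ⟪((-1 : ℝ) ^ κ.length) • r, μ⟫_ℝ = Real.sqrt (2 / 3) ∧ ∀ μ' κ', κ = μ' :: κ' → μ' ≠ -μ) := by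
  simp only [WFChain]

/-- The empty chain is well formed. -/
theorem wfChain_nil (r : EuclideanSpace ℝ (Fin 3)) : WFChain r [] := by simp only [WFChain]

/-- **A chain whose frame has the plate frame's slot dozen is empty** (word rigidity `word_eq_of_image_eq`). -/
theorem chain_eq_nil_of_image_eq (S : PlateSystem) {r : EuclideanSpace ℝ (Fin 3)} {κ : List (EuclideanSpace ℝ (Fin 3))}
    (hκ : WFChain r κ)
    (himg : (S.Fw κ : EuclideanSpace ℝ (Fin 3) → EuclideanSpace ℝ (Fin 3)) '' ↑fccSlots =
      (S.G₀ : EuclideanSpace ℝ (Fin 3) → EuclideanSpace ℝ (Fin 3)) '' ↑fccSlots) : κ = [] :=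
  word_eq_of_image_eq (F := S.Fw) (u := fun κ => ((-1 : ℝ) ^ κ.length) • r) (WF := WFChain r)
    (fw_cons S) (u_cons r) (wfChain_cons r) hκ (wfChain_nil r) himg

/-- **No chain over an in-plane root has the slot dozen of the basal mirror of the plate frame**
(`word_image_ne_cons_of_inner_zero` with the empty prefix and the glide letter `e₃`). -/
theorem image_ne_basalMirror (S : PlateSystem) {r : EuclideanSpace ℝ (Fin 3)} (hr2 : r 2 = 0)
    {κ : List (EuclideanSpace ℝ (Fin 3))} (hκ : WFChain r κ) :
    (S.Fw κ : EuclideanSpace ℝ (Fin 3) → EuclideanSpace ℝ (Fin 3)) '' ↑fccSlots ≠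
      ((((ℝ ∙ EuclideanSpace.single (2 : Fin 3) (1 : ℝ))ᗮ.reflection).trans S.G₀ :
          EuclideanSpace ℝ (Fin 3) ≃ₗᵢ[ℝ] EuclideanSpace ℝ (Fin 3)) :
        EuclideanSpace ℝ (Fin 3) → EuclideanSpace ℝ (Fin 3)) '' ↑fccSlots := by
  have h := word_image_ne_cons_of_inner_zero (F := S.Fw) (u := fun κ => ((-1 : ℝ) ^ κ.length) • r) (WF := WFChain r)
    (fw_cons S) (u_cons r) (wfChain_cons r) (wfChain_nil r) (μ := EuclideanSpace.single (2 : Fin 3) (1 : ℝ))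
    (by rw [PiLp.norm_single, norm_one])
    (fun w hw => by rw [inner_single_two_one]; exact slot_apply_two_cases hw)
    (by simp only [List.length_nil, pow_zero, one_smul]; rw [inner_single_two_one, hr2]) hκ
  exact h

end PlateSystem

/-! ### Slot dozens of the basal mirror and of the half-turn frame -/

/-- `L ∘ M_{e₃}` and `H ∘ L` have the same slot dozen (`M_{e₃} w = H(−w)`). -/
theorem image_fccSlots_basalMirror_eq_halfTurn (L : EuclideanSpace ℝ (Fin 3) ≃ₗᵢ[ℝ] EuclideanSpace ℝ (Fin 3)) :
    ((((ℝ ∙ EuclideanSpace.single (2 : Fin 3) (1 : ℝ))ᗮ.reflection).trans L :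
          EuclideanSpace ℝ (Fin 3) ≃ₗᵢ[ℝ] EuclideanSpace ℝ (Fin 3)) :
        EuclideanSpace ℝ (Fin 3) → EuclideanSpace ℝ (Fin 3)) '' ↑fccSlots =
      ((((ℝ ∙ EuclideanSpace.single (2 : Fin 3) (1 : ℝ)).reflection).trans L :
          EuclideanSpace ℝ (Fin 3) ≃ₗᵢ[ℝ] EuclideanSpace ℝ (Fin 3)) :
        EuclideanSpace ℝ (Fin 3) → EuclideanSpace ℝ (Fin 3)) '' ↑fccSlots := by
  have he : ‖(EuclideanSpace.single (2 : Fin 3) (1 : ℝ))‖ = 1 := by rw [PiLp.norm_single, norm_one]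
  have key : ∀ w : EuclideanSpace ℝ (Fin 3),
      ((ℝ ∙ EuclideanSpace.single (2 : Fin 3) (1 : ℝ))ᗮ.reflection.trans L) w =
        ((ℝ ∙ EuclideanSpace.single (2 : Fin 3) (1 : ℝ)).reflection.trans L) (-w) := by
    intro w
    rw [LinearIsometryEquiv.trans_apply, LinearIsometryEquiv.trans_apply, reflection_unit_apply he, halfTurn_neg_eq,
      inner_single_two_one]
  ext y
  constructor
  · rintro ⟨w, hw, rfl⟩
    exact ⟨-w, Finset.mem_coe.2 (neg_mem_fccSlots (Finset.mem_coe.1 hw)), by rw [key]⟩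
  · rintro ⟨w, hw, rfl⟩
    exact ⟨-w, Finset.mem_coe.2 (neg_mem_fccSlots (Finset.mem_coe.1 hw)), by rw [key, neg_neg]⟩

/-- `(H ∘ L) ∘ M_{e₃}` and `L` have the same slot dozen (`H ∘ M_{e₃} = −1`). -/
theorem image_fccSlots_basalMirror_halfTurn_eq (L : EuclideanSpace ℝ (Fin 3) ≃ₗᵢ[ℝ] EuclideanSpace ℝ (Fin 3)) :
    ((((ℝ ∙ EuclideanSpace.single (2 : Fin 3) (1 : ℝ))ᗮ.reflection).trans
          ((((ℝ ∙ EuclideanSpace.single (2 : Fin 3) (1 : ℝ)).reflection).trans L)) :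
          EuclideanSpace ℝ (Fin 3) ≃ₗᵢ[ℝ] EuclideanSpace ℝ (Fin 3)) :
        EuclideanSpace ℝ (Fin 3) → EuclideanSpace ℝ (Fin 3)) '' ↑fccSlots =
      (L : EuclideanSpace ℝ (Fin 3) → EuclideanSpace ℝ (Fin 3)) '' ↑fccSlots := by
  have he : ‖(EuclideanSpace.single (2 : Fin 3) (1 : ℝ))‖ = 1 := by rw [PiLp.norm_single, norm_one]
  have key : ∀ w : EuclideanSpace ℝ (Fin 3),
      ((ℝ ∙ EuclideanSpace.single (2 : Fin 3) (1 : ℝ))ᗮ.reflection.trans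
        ((ℝ ∙ EuclideanSpace.single (2 : Fin 3) (1 : ℝ)).reflection.trans L)) w = L (-w) := by
    intro w
    rw [LinearIsometryEquiv.trans_apply, LinearIsometryEquiv.trans_apply, reflection_unit_apply he,
      inner_single_two_one, map_sub, LinearIsometryEquiv.map_smul, halfTurn_e₃, halfTurn_apply]
    congr 1; module
  ext y
  constructor
  · rintro ⟨w, hw, rfl⟩
    exact ⟨-w, Finset.mem_coe.2 (neg_mem_fccSlots (Finset.mem_coe.1 hw)), by rw [key]⟩
  · rintro ⟨w, hw, rfl⟩
    exact ⟨-w, Finset.mem_coe.2 (neg_mem_fccSlots (Finset.mem_coe.1 hw)), by rw [key, neg_neg]⟩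

/-! ### v1 end moves carry a FULL or a TWIN reading -/

/-- A `v1` end move from `q` is made from a FULL reading or a TWIN reading at `q`. -/
theorem reading_of_isEndMove_v1 {X : Finset (EuclideanSpace ℝ (Fin 3))}
    {G : EuclideanSpace ℝ (Fin 3) ≃ₗᵢ[ℝ] EuclideanSpace ℝ (Fin 3)} {d q b : EuclideanSpace ℝ (Fin 3)}
    (h : IsEndMove X WordVersion.v1 G d q b) : IsFull X G q ∨ ∃ m, IsTwinReading X G m q := by
  rcases h with ⟨hread, -, -⟩ | ⟨m, hm, -, -, -⟩
  · rcases hread with hf | ⟨hv, -⟩ | ⟨m, hm, -⟩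
    · exact Or.inl hf
    · exact absurd hv (by decide)
    · exact Or.inr ⟨m, hm⟩
  · exact Or.inr ⟨m, hm⟩

/-! ### The twin plate system: root classes only, normal `±K` -/

section TwinPlates

variable (L : EuclideanSpace ℝ (Fin 3) ≃ₗᵢ[ℝ] EuclideanSpace ℝ (Fin 3)) (s₁ s₂ : EuclideanSpace ℝ (Fin 3))
  {X : Finset (EuclideanSpace ℝ (Fin 3))}
  (hX : ∀ x ∈ X, x ∈ (fun p => L p + s₁) '' fccStacking 1 (Real.sqrt (2 / 3)) ∨
    x ∈ (fun p => (((ℝ ∙ EuclideanSpace.single (2 : Fin 3) (1 : ℝ)).reflection).trans L) p + s₂) ''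
      fccStacking 1 (Real.sqrt (2 / 3)))
include hX

/-- **Every twin reading in the twin plate system has normal `±L e₃`** (on-site configurations). -/
theorem isTwinReading_normal_twinPlates {G : EuclideanSpace ℝ (Fin 3) ≃ₗᵢ[ℝ] EuclideanSpace ℝ (Fin 3)}
    {m q : EuclideanSpace ℝ (Fin 3)} (hq : q ∈ X) (h : IsTwinReading X G m q) :
    m = L (EuclideanSpace.single (2 : Fin 3) (1 : ℝ)) ∨ m = -L (EuclideanSpace.single (2 : Fin 3) (1 : ℝ)) := by
  obtain ⟨⟨hm, hmenu⟩, hown, hmir, -⟩ := h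
  exact (twin_reading_twinPlates L s₁ s₂ hX G hm hmenu hq (fun w hw hlt => hown w hw hlt.le) hmir).1

/-- The frame of a `v1` reading is one of the two plate frames. -/
theorem frame_of_reading_twinPlates {G : EuclideanSpace ℝ (Fin 3) ≃ₗᵢ[ℝ] EuclideanSpace ℝ (Fin 3)}
    {q : EuclideanSpace ℝ (Fin 3)} (hq : q ∈ X) (h : IsFull X G q ∨ ∃ m, IsTwinReading X G m q) :
    (G : EuclideanSpace ℝ (Fin 3) → EuclideanSpace ℝ (Fin 3)) '' ↑fccSlots =
        (L : EuclideanSpace ℝ (Fin 3) → EuclideanSpace ℝ (Fin 3)) '' ↑fccSlots ∨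
      (G : EuclideanSpace ℝ (Fin 3) → EuclideanSpace ℝ (Fin 3)) '' ↑fccSlots =
        ((((ℝ ∙ EuclideanSpace.single (2 : Fin 3) (1 : ℝ)).reflection).trans L :
          EuclideanSpace ℝ (Fin 3) ≃ₗᵢ[ℝ] EuclideanSpace ℝ (Fin 3)) :
            EuclideanSpace ℝ (Fin 3) → EuclideanSpace ℝ (Fin 3)) '' ↑fccSlots := by
  rcases h with hf | ⟨m, ⟨hm, hmenu⟩, hown, hmir, -⟩
  · exact full_reading_twoLattice L _ s₁ s₂ hX G hq hf
  · exact (twin_reading_twinPlates L s₁ s₂ hX G hm hmenu hq (fun w hw hlt => hown w hw hlt.le) hmir).2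

/-- **ROOT CLASSES ONLY (twin plates).**  Every `v1` end pair of the two-plate twin net on an on-site configuration is
witnessed by a root class of one of the two plate systems.  See the module docstring. -/
theorem isEndPair_rootClass_twinPlates {b q : EuclideanSpace ℝ (Fin 3)}
    (h : IsEndPair X WordVersion.v1 ⟨L, inPlaneRoots L 1⟩
      ⟨((ℝ ∙ EuclideanSpace.single (2 : Fin 3) (1 : ℝ)).reflection).trans L,
        inPlaneRoots (((ℝ ∙ EuclideanSpace.single (2 : Fin 3) (1 : ℝ)).reflection).trans L) (-1)⟩ b q) :
    ∃ (G : EuclideanSpace ℝ (Fin 3) ≃ₗᵢ[ℝ] EuclideanSpace ℝ (Fin 3)) (d : EuclideanSpace ℝ (Fin 3)),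
      ((G = L ∧ ∃ r ∈ inPlaneRoots L 1, d = L r) ∨
        (G = ((ℝ ∙ EuclideanSpace.single (2 : Fin 3) (1 : ℝ)).reflection).trans L ∧
          ∃ r ∈ inPlaneRoots (((ℝ ∙ EuclideanSpace.single (2 : Fin 3) (1 : ℝ)).reflection).trans L) (-1),
            d = (((ℝ ∙ EuclideanSpace.single (2 : Fin 3) (1 : ℝ)).reflection).trans L) r)) ∧
      IsEndMove X WordVersion.v1 G d q b := by
  set L₂ : EuclideanSpace ℝ (Fin 3) ≃ₗᵢ[ℝ] EuclideanSpace ℝ (Fin 3) :=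
    ((ℝ ∙ EuclideanSpace.single (2 : Fin 3) (1 : ℝ)).reflection).trans L with hL₂
  obtain ⟨hqX, -, -, G, d, hadm, hmove⟩ := h
  have hframe := frame_of_reading_twinPlates L s₁ s₂ hX hqX (reading_of_isEndMove_v1 hmove)
  refine ⟨G, d, ?_, hmove⟩
  rcases hadm with ⟨r, hr, κ, hκ, hG, hd⟩ | ⟨r, hr, κ, hκ, hG, hd⟩
  · -- a class of the bottom system: its frame is `L` (not the twin frame), so `κ = []`
    left
    have hr2 : r 2 = 0 := (Finset.mem_filter.1 hr).2.1
    have hκ0 : κ = [] := by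
      rcases hframe with hfr | hfr
      · exact PlateSystem.chain_eq_nil_of_image_eq ⟨L, inPlaneRoots L 1⟩ hκ (by rw [← hG]; exact hfr)
      · exfalso
        refine PlateSystem.image_ne_basalMirror ⟨L, inPlaneRoots L 1⟩ hr2 hκ ?_
        rw [← hG, hfr]; exact (image_fccSlots_basalMirror_eq_halfTurn L).symm
    subst hκ0
    refine ⟨hG, r, hr, ?_⟩
    rw [hd]; simp [PlateSystem.Fw]
  · right
    have hr2 : r 2 = 0 := (Finset.mem_filter.1 hr).2.1
    have hκ0 : κ = [] := by
      rcases hframe with hfr | hfr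
      · exfalso
        refine PlateSystem.image_ne_basalMirror ⟨L₂, inPlaneRoots L₂ (-1)⟩ hr2 hκ ?_
        rw [← hG, hfr]; exact (image_fccSlots_basalMirror_halfTurn_eq L).symm
      · exact PlateSystem.chain_eq_nil_of_image_eq ⟨L₂, inPlaneRoots L₂ (-1)⟩ hκ (by rw [← hG]; exact hfr)
    subst hκ0
    refine ⟨hG, r, hr, ?_⟩
    rw [hd]; simp [PlateSystem.Fw]

end TwinPlates

/-! ### The translation plate system: root classes only (deep or basal-fault offsets) -/

section TransPlates

variable (L : EuclideanSpace ℝ (Fin 3) ≃ₗᵢ[ℝ] EuclideanSpace ℝ (Fin 3)) (s₁ s₂ : EuclideanSpace ℝ (Fin 3))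
  {X : Finset (EuclideanSpace ℝ (Fin 3))}
  (hX : ∀ x ∈ X, x ∈ (fun p => L p + s₁) '' fccStacking 1 (Real.sqrt (2 / 3)) ∨
    x ∈ (fun p => L p + s₂) '' fccStacking 1 (Real.sqrt (2 / 3)))
include hX

/-- **No twin reading for a DEEP translation pair** (on-site configurations). -/
theorem not_isTwinReading_transPlates_of_deep
    (hdeep : L.symm ((3 : ℝ) • (s₂ - s₁)) ∉ fccStacking 1 (Real.sqrt (2 / 3)))
    {G : EuclideanSpace ℝ (Fin 3) ≃ₗᵢ[ℝ] EuclideanSpace ℝ (Fin 3)} {m q : EuclideanSpace ℝ (Fin 3)} (hq : q ∈ X) :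
    ¬ IsTwinReading X G m q := by
  rintro ⟨⟨hm, hmenu⟩, hown, hmir, -⟩
  exact no_twin_reading_transPlates_of_deep L s₁ s₂ hdeep hX G hm hmenu hq (fun w hw hlt => hown w hw hlt.le) hmir

/-- **Twin readings of a BASAL-FAULT translation pair have normal `±L e₃`.** -/
theorem isTwinReading_normal_transPlates {a' : ℤ}
    (hfault : L.symm (s₂ - s₁ - (a' : ℝ) • (Real.sqrt (2 / 3) • L (EuclideanSpace.single (2 : Fin 3) (1 : ℝ)))) ∈
      fccStacking 1 (Real.sqrt (2 / 3)))
    (hne : L.symm (s₂ - s₁) ∉ fccStacking 1 (Real.sqrt (2 / 3)))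
    {G : EuclideanSpace ℝ (Fin 3) ≃ₗᵢ[ℝ] EuclideanSpace ℝ (Fin 3)} {m q : EuclideanSpace ℝ (Fin 3)} (hq : q ∈ X)
    (h : IsTwinReading X G m q) :
    m = L (EuclideanSpace.single (2 : Fin 3) (1 : ℝ)) ∨ m = -L (EuclideanSpace.single (2 : Fin 3) (1 : ℝ)) := by
  obtain ⟨⟨hm, hmenu⟩, hown, hmir, -⟩ := h
  exact twin_reading_transPlates_normal L s₁ s₂
    (by rw [LinearIsometryEquiv.norm_map, PiLp.norm_single, norm_one]) (menu_axis_frame L) hfault hne hX G hm hmenu hq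
    (fun w hw hlt => hown w hw hlt.le) hmir

/-- The frame of a `v1` reading is the plate frame, for a deep or basal-fault offset. -/
theorem frame_of_reading_transPlates
    (hoff : L.symm ((3 : ℝ) • (s₂ - s₁)) ∉ fccStacking 1 (Real.sqrt (2 / 3)) ∨
      ((∃ a' : ℤ, L.symm (s₂ - s₁ - (a' : ℝ) • (Real.sqrt (2 / 3) • L (EuclideanSpace.single (2 : Fin 3) (1 : ℝ)))) ∈
        fccStacking 1 (Real.sqrt (2 / 3))) ∧ L.symm (s₂ - s₁) ∉ fccStacking 1 (Real.sqrt (2 / 3))))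
    {G : EuclideanSpace ℝ (Fin 3) ≃ₗᵢ[ℝ] EuclideanSpace ℝ (Fin 3)}
    {q : EuclideanSpace ℝ (Fin 3)} (hq : q ∈ X) (h : IsFull X G q ∨ ∃ m, IsTwinReading X G m q) :
    (G : EuclideanSpace ℝ (Fin 3) → EuclideanSpace ℝ (Fin 3)) '' ↑fccSlots =
        (L : EuclideanSpace ℝ (Fin 3) → EuclideanSpace ℝ (Fin 3)) '' ↑fccSlots ∨
      (G : EuclideanSpace ℝ (Fin 3) → EuclideanSpace ℝ (Fin 3)) '' ↑fccSlots =
        ((((ℝ ∙ EuclideanSpace.single (2 : Fin 3) (1 : ℝ))ᗮ.reflection).trans L :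
          EuclideanSpace ℝ (Fin 3) ≃ₗᵢ[ℝ] EuclideanSpace ℝ (Fin 3)) :
            EuclideanSpace ℝ (Fin 3) → EuclideanSpace ℝ (Fin 3)) '' ↑fccSlots := by
  rcases h with hf | ⟨m, hread⟩
  · left
    rcases full_reading_twoLattice L L s₁ s₂ hX G hq hf with h | h
    · exact h
    · exact h
  · rcases hoff with hdeep | ⟨⟨a', hfault⟩, hne⟩
    · exact absurd hread (not_isTwinReading_transPlates_of_deep L s₁ s₂ hX hdeep hq)
    · have hmK := isTwinReading_normal_transPlates L s₁ s₂ hX hfault hne hq hread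
      obtain ⟨⟨hm, hmenu⟩, hown, hmir, -⟩ := hread
      obtain ⟨-, hfr⟩ := twin_reading_transPlates L s₁ s₂ hX G hm hmenu hq (fun w hw hlt => hown w hw hlt.le) hmir
      rcases hfr with hfr | hfr
      · exact Or.inl hfr
      · right
        -- `(M_m ∘ G)·slots = L·slots` with `m = ±L e₃` ⇒ `G·slots = (L ∘ M_{e₃})·slots`
        have he : ‖(EuclideanSpace.single (2 : Fin 3) (1 : ℝ))‖ = 1 := by rw [PiLp.norm_single, norm_one]
        have hMm : ∀ x, (ℝ ∙ m)ᗮ.reflection x = L ((ℝ ∙ EuclideanSpace.single (2 : Fin 3) (1 : ℝ))ᗮ.reflection (L.symm x)) := by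
          intro x
          rw [reflection_unit_apply hm, reflection_unit_apply he, map_sub, LinearIsometryEquiv.map_smul,
            LinearIsometryEquiv.apply_symm_apply, inner_single_two_one]
          have hin : ⟪x, m⟫_ℝ • m = (L.symm x) 2 • L (EuclideanSpace.single (2 : Fin 3) (1 : ℝ)) := by
            rcases hmK with rfl | rfl
            · rw [← inner_frame_axis L (L.symm x), LinearIsometryEquiv.apply_symm_apply]
            · rw [inner_neg_right, smul_neg, neg_smul, neg_neg, ← inner_frame_axis L (L.symm x),
                LinearIsometryEquiv.apply_symm_apply]
          rw [mul_smul, mul_smul, hin]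
        ext y
        constructor
        · rintro ⟨w, hw, rfl⟩
          obtain ⟨w', hw', hww'⟩ : (G.trans (ℝ ∙ m)ᗮ.reflection) w ∈
              (L : EuclideanSpace ℝ (Fin 3) → EuclideanSpace ℝ (Fin 3)) '' ↑fccSlots := hfr ▸ ⟨w, hw, rfl⟩
          refine ⟨w', hw', ?_⟩
          rw [LinearIsometryEquiv.trans_apply] at hww'
          have : G w = (ℝ ∙ m)ᗮ.reflection (L w') := by rw [hww', Submodule.reflection_reflection]
          rw [this, hMm, LinearIsometryEquiv.symm_apply_apply, LinearIsometryEquiv.trans_apply]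
        · rintro ⟨w', hw', rfl⟩
          have hmem : L w' ∈ (L : EuclideanSpace ℝ (Fin 3) → EuclideanSpace ℝ (Fin 3)) '' ↑fccSlots := ⟨w', hw', rfl⟩
          rw [← hfr] at hmem
          obtain ⟨w, hw, hww⟩ := hmem
          refine ⟨w, hw, ?_⟩
          rw [LinearIsometryEquiv.trans_apply] at hww
          have : G w = (ℝ ∙ m)ᗮ.reflection (L w') := by rw [← hww, Submodule.reflection_reflection]
          rw [this, hMm, LinearIsometryEquiv.symm_apply_apply, LinearIsometryEquiv.trans_apply]

/-- **ROOT CLASSES ONLY (translation plates, deep or basal-fault offset).**  See the module docstring. -/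
theorem isEndPair_rootClass_transPlates
    (hoff : L.symm ((3 : ℝ) • (s₂ - s₁)) ∉ fccStacking 1 (Real.sqrt (2 / 3)) ∨
      ((∃ a' : ℤ, L.symm (s₂ - s₁ - (a' : ℝ) • (Real.sqrt (2 / 3) • L (EuclideanSpace.single (2 : Fin 3) (1 : ℝ)))) ∈
        fccStacking 1 (Real.sqrt (2 / 3))) ∧ L.symm (s₂ - s₁) ∉ fccStacking 1 (Real.sqrt (2 / 3))))
    {b q : EuclideanSpace ℝ (Fin 3)}
    (h : IsEndPair X WordVersion.v1 ⟨L, inPlaneRoots L 1⟩ ⟨L, inPlaneRoots L (-1)⟩ b q) :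
    ∃ (d : EuclideanSpace ℝ (Fin 3)),
      (∃ r ∈ inPlaneRoots L 1 ∪ inPlaneRoots L (-1), d = L r) ∧ IsEndMove X WordVersion.v1 L d q b := by
  obtain ⟨hqX, -, -, G, d, hadm, hmove⟩ := h
  have hframe := frame_of_reading_transPlates L s₁ s₂ hX hoff hqX (reading_of_isEndMove_v1 hmove)
  have main : ∀ (sgn : ℝ), (⟨L, inPlaneRoots L sgn⟩ : PlateSystem).Adm G d →
      G = L ∧ ∃ r ∈ inPlaneRoots L sgn, d = L r := by
    rintro sgn ⟨r, hr, κ, hκ, hG, hd⟩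
    have hr2 : r 2 = 0 := (Finset.mem_filter.1 hr).2.1
    have hκ0 : κ = [] := by
      rcases hframe with hfr | hfr
      · exact PlateSystem.chain_eq_nil_of_image_eq ⟨L, inPlaneRoots L sgn⟩ hκ (by rw [← hG]; exact hfr)
      · exfalso
        exact PlateSystem.image_ne_basalMirror ⟨L, inPlaneRoots L sgn⟩ hr2 hκ (by rw [← hG]; exact hfr)
    subst hκ0
    refine ⟨hG, r, hr, ?_⟩
    rw [hd]; simp [PlateSystem.Fw]
  rcases hadm with hadm | hadm
  · obtain ⟨hG, r, hr, hd⟩ := main 1 hadm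
    exact ⟨d, ⟨r, Finset.mem_union_left _ hr, hd⟩, hG ▸ hmove⟩
  · obtain ⟨hG, r, hr, hd⟩ := main (-1) hadm
    exact ⟨d, ⟨r, Finset.mem_union_right _ hr, hd⟩, hG ▸ hmove⟩

end TransPlates

end Summit.Ventures.Crystal3D.Theorems

end
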